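import Literature.Probability.RandomPlanarGeometry.HexSAWBrickWallKestenRelation
import Literature.Probability.RandomPlanarGeometry.HexSAWHalfSpaceRatioLimit
import Literature.Probability.RandomPlanarGeometry.SAWHalfSpaceRatioOneStep
import HarnessLib

/-!
# The ONE-step ratio of half-space walks on the hexagonal lattice: `h_{N+1}(ℍ)/h_N(ℍ) → μ_ℍ = √(2+√2)`

Topic `Literature/Probability/RandomPlanarGeometry`. Lane «pcv-sawmu», door R84 «HEX-HALFSPACE-RATIO-1» — FINAL.
Lawler–Schramm–Werner's argument (2004, Appendix A, (A.1)+(A.2) ⇒ (A.3)) is in the tree MODEL-FREE as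
`LSWRatio.tendsto_ratio_succ`; on the honeycomb lattice (brick-wall half-space walks `HexBW.halfSpaceCount`,
height = coordinate `0`) its inputs are: (A.2)_ℍ = `hexHalfSpaceRatioTwo` (`HexSAWHalfSpaceRatioLimit.lean`: Kesten's
two-step inequality by hexagon surgery, Duminil-Copin–Smirnov's `μ_ℍ = √(2+√2)`); the renewal inequality
`HexBW.sum_irreducibleBridgeCount_mul_halfSpaceCount_le` and `λ_0 = 0 < λ_1` (`HexSAWBrickWallRenewal.lean`); and
(A.1)_ℍ = Kesten's relation `HexBW.kestenRelation` (`HexSAWBrickWallKestenRelation.lean`, from the renewal equation,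
the divergence `HexBW.not_summable_bridgeCount_div_pow` of a-p6 g5's `HexSAWBrickWallBridgeDivergence.lean`, and
Feller's recurrence criterion).

Status in print: (A.3) `υ_{n+1}/υ_n → β` is printed and proved for `ℤ^d` (tree: `Zd.LawlerSchrammWerner2004_eqA3`);
no count-ratio statement (one- or two-step, limit or rate) is printed for half-plane self-avoiding walks of the
honeycomb lattice in any frame.  New in writing; consolidation of printed mechanisms (LSW renewal argument + Kesten /
Madras–Slade bridge renewal theory + Duminil-Copin–Smirnov); first kernel text.
-/

noncomputable section

open Filter Topology Finset

namespace Literature.Probability.RandomPlanarGeometry.SAW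

/-- **`h_{N+1}(ℍ)/h_N(ℍ) → √(2+√2)` from Kesten's relation for brick-wall bridges** (the form in which the LSW
argument consumes it): if `Σ_k λ_k(ℍ) μ_ℍ^{-k} = 1`, then the one-step ratio of brick-wall half-space walk counts
converges to `μ_ℍ = √(2+√2)`, by the tree's model-free `LSWRatio.tendsto_ratio_succ` fed with (A.2)_ℍ
`hexHalfSpaceRatioTwo` and the renewal inequality `HexBW.sum_irreducibleBridgeCount_mul_halfSpaceCount_le`.
[cite: LawlerSchrammWerner2004SAW, Appendix A, (A.1)–(A.3)] -/
theorem hexHalfSpaceRatioOne_of_kestenRelation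
    (hK : HasSum (fun k => (HexBW.irreducibleBridgeCount k : ℝ) / hexConnectiveConstant ^ k) 1) :
    Tendsto (fun N : ℕ => (HexBW.halfSpaceCount (N + 1) : ℝ) / HexBW.halfSpaceCount N) atTop
      (𝓝 (Real.sqrt (2 + Real.sqrt 2))) := by
  have hμ := hexConnectiveConstant_eq_of_thm1 DuminilCopinSmirnov2012_thm1_holds
  have hμpos : 0 < hexConnectiveConstant := hexConnectiveConstant_pos
  have hμsq : hexConnectiveConstant ^ 2 = 2 + Real.sqrt 2 := by
    rw [hμ]; exact Real.sq_sqrt (by positivity)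
  have hu : ∀ n, (0 : ℝ) < HexBW.halfSpaceCount n := fun n => by
    have h1 : (1 : ℝ) ≤ HexBW.bridgeCount n := by exact_mod_cast HexBW.one_le_bridgeCount n
    have h2 : (HexBW.bridgeCount n : ℝ) ≤ HexBW.halfSpaceCount n := by
      exact_mod_cast Finset.card_le_card (HexBW.bridges_subset_halfSpaceWalks n)
    linarith
  have hA2 : Tendsto (fun n : ℕ => (HexBW.halfSpaceCount (n + 2) : ℝ) / HexBW.halfSpaceCount n) atTop
      (𝓝 (hexConnectiveConstant ^ 2)) := by
    rw [hμsq]; exact hexHalfSpaceRatioTwo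
  have hren : ∀ n : ℕ, 1 ≤ n → ∑ j ∈ Icc 1 n, (HexBW.irreducibleBridgeCount j : ℝ) *
      HexBW.halfSpaceCount (n - j) ≤ HexBW.halfSpaceCount n := fun n _ => by
    exact_mod_cast HexBW.sum_irreducibleBridgeCount_mul_halfSpaceCount_le n
  have h := LSWRatio.tendsto_ratio_succ (u := fun n => (HexBW.halfSpaceCount n : ℝ))
    (lam := fun j => (HexBW.irreducibleBridgeCount j : ℝ)) (β := hexConnectiveConstant) hμpos hu
    (fun j => Nat.cast_nonneg _) (by simp [HexBW.irreducibleBridgeCount_zero])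
    (by exact_mod_cast HexBW.irreducibleBridgeCount_one_pos) hK hA2 hren
  rwa [hμ] at h

/-- **`h_{N+1}(ℍ)/h_N(ℍ) → √(2+√2)` — the ONE-step ratio of half-space self-avoiding walks on the hexagonal lattice
converges to the connective constant** (Lawler–Schramm–Werner (A.3) on `ℍ`; `h_N(ℍ) = HexBW.halfSpaceCount N`, the
`N`-step honeycomb walks in brick-wall coordinates staying strictly on one side of the column of their start).  NO
hypotheses: (A.2)_ℍ `hexHalfSpaceRatioTwo`, Kesten's relation `HexBW.kestenRelation`, the renewal inequality, and the
tree's model-free LSW argument `LSWRatio.tendsto_ratio_succ`.  Not in print for `ℍ` (`ℤ^d`: LSW 2004 (A.3), tree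
`Zd.LawlerSchrammWerner2004_eqA3`). [cite: LawlerSchrammWerner2004SAW, Appendix A, (A.1)–(A.3)] -/
theorem hexHalfSpaceRatioOne :
    Tendsto (fun N : ℕ => (HexBW.halfSpaceCount (N + 1) : ℝ) / HexBW.halfSpaceCount N) atTop
      (𝓝 (Real.sqrt (2 + Real.sqrt 2))) :=
  hexHalfSpaceRatioOne_of_kestenRelation HexBW.kestenRelation

/-- The one-step ratio in terms of the connective constant: `h_{N+1}(ℍ)/h_N(ℍ) → μ_ℍ`. [cite: LawlerSchrammWerner2004SAW, Appendix A, (A.3)] -/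
theorem hexHalfSpaceRatioOne' :
    Tendsto (fun N : ℕ => (HexBW.halfSpaceCount (N + 1) : ℝ) / HexBW.halfSpaceCount N) atTop
      (𝓝 hexConnectiveConstant) := by
  rw [hexConnectiveConstant_eq_of_thm1 DuminilCopinSmirnov2012_thm1_holds]
  exact hexHalfSpaceRatioOne

end Literature.Probability.RandomPlanarGeometry.SAW
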